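import Mathlib.MeasureTheory.Function.ContinuousMapDense
import Mathlib.MeasureTheory.Integral.Bochner.Set
import Mathlib.MeasureTheory.Group.Integral
import Mathlib.MeasureTheory.Measure.Haar.OfBasis
import Mathlib.Topology.UniformSpace.HeineCantor
import Literature.NumberTheory.Transcendental.SemialgebraicVolume

/-!
# Route StandardParts — `SpArcLifting` (stmt-KontsevichZagierPeriods-3155): rational step functions
are `L¹`-dense (measure-theoretic half of "KZ classes are `L¹`-dense in their value slice")

Problem `KontsevichZagierPeriods`, route `StandardParts`, crux item stmt-KontsevichZagierPeriods-3155
(`SpArcLifting`), line `registered`, lead c2. Helper file (`--supports`).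

Pure measure theory on `ℝⁿ = (Fin n → ℝ)`, no calculus of moves yet:

* `exists_step_integral_abs_sub_le` — every integrable `g` is within `ε` in `L¹` of a RATIONAL STEP
  FUNCTION on an integer translate of a dyadic grid: `s x = ∑_{K < Lⁿ} q_K · 𝟙_{C_K} (x + R)` with
  `q_K ∈ ℚ`, `C_K = hoCube j (digits n L K)` the half-open dyadic cubes of level `j` tiling the box
  `[0, 2R)ⁿ` (`Literature/NumberTheory/Transcendental/SemialgebraicVolume.lean`), `R ∈ ℕ`.
  Proof: compactly supported continuous approximation (Mathlib), uniform continuity on the grid,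
  rational rounding of the values at the lower corners.
* `exists_step_integral_abs_sub_le_of_integral_eq_zero` — if moreover `∫ g = 0`, the coefficients
  can be taken with `∑_K q_K = 0` (subtract the rational total `∫ s / vol(cube)` from one
  coefficient; it is small because `|∫ s| = |∫ (s − g)| ≤ ‖s − g‖₁`).

The companion file `StandardPartsSpArcLiftingNullSteps.lean` shows that such zero-sum step functions
are RELATIONS of the Kontsevich–Zagier calculus, and `StandardPartsSpArcLiftingDensity.lean` concludes.

Sources: M. Kontsevich, D. Zagier, *Periods* (2001), §1.2 [KontsevichZagier2001]; M. Yoshinaga,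
*Periods and elementary real numbers*, arXiv:0805.0349, §3.4 (dyadic cubes) [Yoshinaga2008].
-/

noncomputable section

namespace Summit.KontsevichZagierPeriods.StandardParts

open MeasureTheory Set Filter Topology
open Literature.NumberTheory.Transcendental (hoCube cubeLo cubeHi closedCube digits
  mem_hoCube_floor eq_of_mem_hoCube hoCube_subset_closedCube dist_le_of_mem_closedCube
  exists_digits_eq digits_injOn measurableSet_hoCube volume_hoCube cubeLo_le_cubeHi)

variable {n : ℕ}

/-! ### Dyadic cubes of the grid on `[0, L/2ʲ)ⁿ` -/

/-- The digits of a code are below the base. [folklore] -/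
theorem digits_lt {L : ℕ} (hL : 0 < L) (K : ℕ) (i : Fin n) : digits n L K i < L :=
  Nat.mod_lt _ hL

/-- A point of the half-open cube with code `K < Lⁿ` at level `j` lies in the box `[0, L/2ʲ)ⁿ`.
[cite: Yoshinaga2008, §3.4] -/
theorem mem_box_of_mem_hoCube_digits {j L : ℕ} (hL : 0 < L) {K : ℕ} {y : Fin n → ℝ}
    (hy : y ∈ hoCube j (digits n L K)) (i : Fin n) : 0 ≤ y i ∧ y i < (L : ℝ) / 2 ^ j := by
  have h := hy i (mem_univ i)
  simp only [cubeLo, cubeHi, mem_Ico] at h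
  have hpos : (0 : ℝ) < 2 ^ j := by positivity
  have hk : ((digits n L K i : ℕ) : ℝ) + 1 ≤ L := by
    exact_mod_cast Nat.succ_le_of_lt (digits_lt hL K i)
  refine ⟨le_trans (by positivity) h.1, lt_of_lt_of_le h.2 ?_⟩
  exact div_le_div_of_nonneg_right hk hpos.le

/-- The translated indicator of a dyadic cube, scaled by a constant, is integrable. [folklore] -/
theorem integrable_const_mul_indicator_hoCube (j : ℕ) (k : Fin n → ℕ) (a : ℝ) (c : Fin n → ℝ) :
    Integrable (fun x : Fin n → ℝ => a * (hoCube j k).indicator 1 (x + c)) := by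
  have h1 : Integrable (fun y : Fin n → ℝ => (hoCube j k).indicator (1 : (Fin n → ℝ) → ℝ) y) := by
    refine (integrable_indicator_iff (measurableSet_hoCube j k)).2 (integrableOn_const ?_)
    rw [volume_hoCube]
    exact ENNReal.ofReal_ne_top
  exact (h1.comp_add_right c).const_mul a

/-- The integral of the translated indicator of a dyadic cube of level `j`, scaled by `a`, is
`a · 2^{-jn}`. [folklore] -/
theorem integral_const_mul_indicator_hoCube (j : ℕ) (k : Fin n → ℕ) (a : ℝ) (c : Fin n → ℝ) :
    ∫ x : Fin n → ℝ, a * (hoCube j k).indicator 1 (x + c) = a * (1 / 2 ^ j) ^ n := by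
  rw [integral_const_mul]
  congr 1
  rw [integral_add_right_eq_self (fun y : Fin n → ℝ => (hoCube j k).indicator (1 : (Fin n → ℝ) → ℝ) y) c,
    integral_indicator_one (measurableSet_hoCube j k), measureReal_def, volume_hoCube,
    ENNReal.toReal_ofReal (by positivity)]

/-! ### Rational step functions are `L¹`-dense -/

/-- **Rational step functions on translated dyadic grids are dense in `L¹(ℝⁿ)`.** For every
integrable `g : ℝⁿ → ℝ` and `ε > 0` there are a level `j`, a box parameter `R ∈ ℕ` (with
`L = 2R·2ʲ` cubes along each axis) and rational coefficients `q_K` such that the step function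
`s x = ∑_{K < Lⁿ} q_K · 𝟙_{hoCube j (digits n L K)} (x + R)` satisfies `∫ |g − s| ≤ ε`.
Proof: `g` is within `ε/2` of a continuous compactly supported `φ` (Mathlib); `φ` vanishes off the
box `[−R, R)ⁿ` and is uniformly continuous, so on each cube of mesh `2⁻ʲ < δ` it is within `η` of its
value at the lower corner, which is within `η` of a rational `q_K`; hence `|φ − s| ≤ 2η · 𝟙_{[−R,R)ⁿ}`
and `∫ |φ − s| ≤ 2η (2R)ⁿ ≤ ε/2`. [cite: Yoshinaga2008, §3.4] -/
theorem exists_step_integral_abs_sub_le (g : (Fin n → ℝ) → ℝ) (hg : Integrable g) {ε : ℝ}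
    (hε : 0 < ε) :
    ∃ (j L R : ℕ) (q : ℕ → ℚ), 0 < L ∧ (L : ℝ) / 2 ^ j = 2 * R ∧
      Integrable (fun x => ∑ K ∈ Finset.range (L ^ n),
        (q K : ℝ) * (hoCube j (digits n L K)).indicator 1 (x + fun _ => (R : ℝ))) ∧
      ∫ x, |g x - ∑ K ∈ Finset.range (L ^ n),
        (q K : ℝ) * (hoCube j (digits n L K)).indicator 1 (x + fun _ => (R : ℝ))| ≤ ε := by
  -- Step 1: a continuous compactly supported approximation
  obtain ⟨φ, hφs, hφg, hφc, hφi⟩ := hg.exists_hasCompactSupport_integral_sub_le (half_pos hε)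
  -- Step 2: a box `[−R, R)ⁿ` off which `φ` vanishes
  obtain ⟨C, hC⟩ := hφs.isCompact.isBounded.exists_norm_le
  set R : ℕ := ⌈C⌉₊ + 1 with hR
  have hCR : C < R := by
    rw [hR, Nat.cast_add, Nat.cast_one]
    exact (Nat.le_ceil C).trans_lt (lt_add_one _)
  have hsupp : ∀ x, φ x ≠ 0 → ∀ i, |x i| < R := fun x hx i => by
    have hx' : x ∈ tsupport φ := subset_tsupport _ (Function.mem_support.2 hx)
    have h1 : ‖x i‖ ≤ ‖x‖ := norm_le_pi_norm x i
    rw [Real.norm_eq_abs] at h1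
    exact (h1.trans (hC x hx')).trans_lt hCR
  -- Step 3: uniform continuity of `φ`
  set V : ℝ := (2 * R) ^ n with hV
  have hV0 : 0 < V := by positivity
  set η : ℝ := ε / 2 / (2 * V + 1) with hη
  have hη0 : 0 < η := by positivity
  obtain ⟨δ, hδ0, hδ⟩ := Metric.uniformContinuous_iff.mp
    (hφs.uniformContinuous_of_continuous hφc) η hη0
  -- Step 4: the level `j` of the grid
  obtain ⟨j, hj⟩ := exists_pow_lt_of_lt_one hδ0 (by norm_num : (1 / 2 : ℝ) < 1)
  have hj' : (1 : ℝ) / 2 ^ j < δ := by rwa [← one_div_pow]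
  -- Step 5: the grid and the rational coefficients
  set L : ℕ := 2 * R * 2 ^ j with hL
  have hR0 : 0 < R := by rw [hR]; exact Nat.succ_pos _
  have hL0 : 0 < L := by rw [hL]; positivity
  have hLR : (L : ℝ) / 2 ^ j = 2 * R := by
    rw [hL]
    push_cast
    field_simp
  set c : Fin n → ℝ := fun _ => (R : ℝ) with hc
  have hq : ∀ K : ℕ, ∃ q : ℚ, |φ (cubeLo j (digits n L K) - c) - q| < η := fun K => by
    obtain ⟨q, h1, h2⟩ := exists_rat_btwn (show φ (cubeLo j (digits n L K) - c) - η <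
      φ (cubeLo j (digits n L K) - c) + η by linarith)
    exact ⟨q, by rw [abs_sub_lt_iff]; constructor <;> linarith⟩
  choose q hq using hq
  set s : (Fin n → ℝ) → ℝ := fun x => ∑ K ∈ Finset.range (L ^ n),
    (q K : ℝ) * (hoCube j (digits n L K)).indicator 1 (x + c) with hs
  set B : Set (Fin n → ℝ) := Set.pi univ fun _ => Ico (-(R : ℝ)) R with hB
  -- cubes of the grid lie over the box
  have hcube_box : ∀ K (y : Fin n → ℝ), y ∈ hoCube j (digits n L K) →
      ∀ i, 0 ≤ y i ∧ y i < 2 * R := fun K y hy i => by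
    have h := mem_box_of_mem_hoCube_digits hL0 hy i
    rw [hLR] at h
    exact h
  -- Step 6: the pointwise estimate `|φ − s| ≤ 2η · 𝟙_B`
  have key : ∀ x, |φ x - s x| ≤ 2 * η * B.indicator 1 x := by
    intro x
    by_cases hx : x ∈ B
    · rw [indicator_of_mem hx, Pi.one_apply, mul_one]
      have hxB : ∀ i, -(R : ℝ) ≤ x i ∧ x i < R := fun i => by
        have := hx i (mem_univ i)
        exact this
      have hy : ∀ i, 0 ≤ (x + c) i ∧ (x + c) i * 2 ^ j < L := fun i => by
        have h1 := hxB i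
        simp only [Pi.add_apply, hc]
        refine ⟨by linarith [h1.1], ?_⟩
        have h2 : x i + R < (L : ℝ) / 2 ^ j := by rw [hLR]; linarith [h1.2]
        rwa [lt_div_iff₀ (by positivity)] at h2
      set k : Fin n → ℕ := fun i => ⌊(x + c) i * 2 ^ j⌋₊ with hk
      have hyk : x + c ∈ hoCube j k := mem_hoCube_floor fun i => (hy i).1
      have hklt : ∀ i, k i < L := fun i =>
        (Nat.floor_lt (mul_nonneg (hy i).1 (by positivity))).2 (hy i).2
      obtain ⟨K₀, hK₀, hK₀k⟩ := exists_digits_eq k hklt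
      have hsx : s x = q K₀ := by
        simp only [hs]
        rw [Finset.sum_eq_single_of_mem K₀ (Finset.mem_range.2 hK₀)]
        · rw [hK₀k, indicator_of_mem hyk, Pi.one_apply, mul_one]
        · intro K hK hne
          rw [indicator_of_notMem, mul_zero]
          intro hmem
          apply hne
          have h1 : digits n L K = k := eq_of_mem_hoCube hmem hyk
          exact digits_injOn n L (Finset.mem_range.1 hK) hK₀ (h1.trans hK₀k.symm)
      rw [hsx]
      have hdist : dist x (cubeLo j k - c) < δ := by
        have h1 : dist (x + c) (cubeLo j k) ≤ 1 / 2 ^ j :=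
          dist_le_of_mem_closedCube (hoCube_subset_closedCube j k hyk)
            ⟨le_rfl, cubeLo_le_cubeHi j k⟩
        have h2 : dist x (cubeLo j k - c) = dist (x + c) (cubeLo j k) := by
          rw [dist_eq_norm, dist_eq_norm]
          congr 1
          abel
        rw [h2]
        exact h1.trans_lt hj'
      have h3 : dist (φ x) (φ (cubeLo j k - c)) < η := hδ hdist
      rw [Real.dist_eq] at h3
      have h4 := hq K₀
      rw [hK₀k] at h4
      calc |φ x - q K₀| = |(φ x - φ (cubeLo j k - c)) + (φ (cubeLo j k - c) - q K₀)| := by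
            ring_nf
        _ ≤ |φ x - φ (cubeLo j k - c)| + |φ (cubeLo j k - c) - q K₀| := abs_add_le _ _
        _ ≤ 2 * η := by linarith
    · rw [indicator_of_notMem hx, mul_zero]
      have hs0 : s x = 0 := by
        simp only [hs]
        refine Finset.sum_eq_zero fun K _ => ?_
        rw [indicator_of_notMem, mul_zero]
        intro hmem
        apply hx
        intro i _
        have := hcube_box K _ hmem i
        simp only [Pi.add_apply, hc] at this
        simp only [mem_Ico]
        constructor <;> linarith [this.1, this.2]
      have hφ0 : φ x = 0 := by
        by_contra hne
        apply hx
        intro i _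
        have := hsupp x hne i
        rw [abs_lt] at this
        exact ⟨this.1.le, this.2⟩
      rw [hs0, hφ0, sub_zero, abs_zero]
  -- Step 7: integrability of the step function
  have hsi : Integrable s :=
    integrable_finsetSum _ fun K _ => integrable_const_mul_indicator_hoCube j _ _ c
  -- Step 8: the integral estimate
  have hB_meas : MeasurableSet B := MeasurableSet.univ_pi fun _ => measurableSet_Ico
  have hB_vol : volume.real B = V := by
    rw [measureReal_def, hB, Real.volume_pi_Ico]
    simp only [Finset.prod_const, Finset.card_univ, Fintype.card_fin]
    have h2R : (R : ℝ) - -(R : ℝ) = 2 * R := by ring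
    rw [ENNReal.toReal_pow, h2R, ENNReal.toReal_ofReal (by positivity), hV]
  have hBi : Integrable (fun x => 2 * η * B.indicator (1 : (Fin n → ℝ) → ℝ) x) := by
    refine Integrable.const_mul ?_ _
    refine (integrable_indicator_iff hB_meas).2 (integrableOn_const ?_)
    rw [hB, Real.volume_pi_Ico]
    exact ENNReal.prod_ne_top fun _ _ => ENNReal.ofReal_ne_top
  have h1 : ∫ x, |φ x - s x| ≤ 2 * η * V := by
    calc ∫ x, |φ x - s x| ≤ ∫ x, 2 * η * B.indicator 1 x :=
          integral_mono (hφi.sub hsi).abs hBi key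
      _ = 2 * η * volume.real B := by
          rw [integral_const_mul, integral_indicator_one hB_meas]
      _ = 2 * η * V := by rw [hB_vol]
  have i1 : Integrable (fun x => |g x - φ x|) := (hg.sub hφi).abs
  have i2 : Integrable (fun x => |φ x - s x|) := (hφi.sub hsi).abs
  have i3 : Integrable (fun x => |g x - s x|) := (hg.sub hsi).abs
  have h2 : ∫ x, |g x - s x| ≤ (∫ x, |g x - φ x|) + ∫ x, |φ x - s x| := by
    rw [← integral_add i1 i2]
    refine integral_mono i3 (i1.add i2) fun x => ?_
    calc |g x - s x| = |(g x - φ x) + (φ x - s x)| := by ring_nf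
      _ ≤ |g x - φ x| + |φ x - s x| := abs_add_le _ _
  have h3 : ∫ x, |g x - φ x| ≤ ε / 2 := by simpa only [Real.norm_eq_abs] using hφg
  have h4 : 2 * η * V ≤ ε / 2 := by
    have h5 : 2 * V / (2 * V + 1) ≤ 1 := by
      rw [div_le_one (by positivity)]
      linarith
    calc 2 * η * V = ε / 2 * (2 * V / (2 * V + 1)) := by rw [hη]; ring
      _ ≤ ε / 2 * 1 := by gcongr
      _ = ε / 2 := mul_one _
  refine ⟨j, L, R, q, hL0, hLR, hsi, ?_⟩
  calc ∫ x, |g x - s x| ≤ ε / 2 + ε / 2 := h2.trans (add_le_add h3 (h1.trans h4))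
    _ = ε := add_halves ε

/-- **Zero-sum version.** If moreover `∫ g = 0`, the rational step function of
`exists_step_integral_abs_sub_le` can be chosen with coefficients summing to ZERO: the total
`T = ∑_K q_K` satisfies `|T| · 2^{-jn} = |∫ s| = |∫ (s − g)| ≤ ε/2`, so subtracting `T` from the
coefficient of the cube with code `0` costs at most `ε/2` in `L¹`. [cite: Yoshinaga2008, §3.4] -/
theorem exists_step_integral_abs_sub_le_of_integral_eq_zero (g : (Fin n → ℝ) → ℝ)
    (hg : Integrable g) (hg0 : ∫ x, g x = 0) {ε : ℝ} (hε : 0 < ε) :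
    ∃ (j L R : ℕ) (q : ℕ → ℚ), 0 < L ∧ (L : ℝ) / 2 ^ j = 2 * R ∧
      ∑ K ∈ Finset.range (L ^ n), q K = 0 ∧
      Integrable (fun x => ∑ K ∈ Finset.range (L ^ n),
        (q K : ℝ) * (hoCube j (digits n L K)).indicator 1 (x + fun _ => (R : ℝ))) ∧
      ∫ x, |g x - ∑ K ∈ Finset.range (L ^ n),
        (q K : ℝ) * (hoCube j (digits n L K)).indicator 1 (x + fun _ => (R : ℝ))| ≤ ε := by
  obtain ⟨j, L, R, q, hL0, hLR, hsi, hs⟩ := exists_step_integral_abs_sub_le g hg (half_pos hε)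
  set c : Fin n → ℝ := fun _ => (R : ℝ) with hc
  set T : ℚ := ∑ K ∈ Finset.range (L ^ n), q K with hT
  set v : ℝ := (1 / 2 ^ j) ^ n with hv
  have hv0 : 0 < v := by positivity
  -- the corrected coefficients
  set q' : ℕ → ℚ := fun K => if K = 0 then q 0 - T else q K with hq'
  have h0mem : (0 : ℕ) ∈ Finset.range (L ^ n) := Finset.mem_range.2 (pow_pos hL0 n)
  have hsum' : ∑ K ∈ Finset.range (L ^ n), q' K = 0 := by
    have : ∀ K ∈ Finset.range (L ^ n), q' K = q K + (if K = 0 then -T else 0) := fun K _ => by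
      simp only [hq']
      split_ifs with h
      · subst h; ring
      · ring
    rw [Finset.sum_congr rfl this, Finset.sum_add_distrib, Finset.sum_ite_eq' _ (0 : ℕ),
      if_pos h0mem, ← hT]
    ring
  set s : (Fin n → ℝ) → ℝ := fun x => ∑ K ∈ Finset.range (L ^ n),
    (q K : ℝ) * (hoCube j (digits n L K)).indicator 1 (x + c) with hsdef
  set s' : (Fin n → ℝ) → ℝ := fun x => ∑ K ∈ Finset.range (L ^ n),
    (q' K : ℝ) * (hoCube j (digits n L K)).indicator 1 (x + c) with hs'def
  set d : (Fin n → ℝ) → ℝ := fun x =>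
    (T : ℝ) * (hoCube j (digits n L 0)).indicator 1 (x + c) with hd
  have hss' : ∀ x, s' x = s x - d x := fun x => by
    simp only [hs'def, hsdef, hd]
    have : ∀ K ∈ Finset.range (L ^ n),
        (q' K : ℝ) * (hoCube j (digits n L K)).indicator 1 (x + c) =
          (q K : ℝ) * (hoCube j (digits n L K)).indicator 1 (x + c) +
            (if K = 0 then -(T : ℝ) * (hoCube j (digits n L 0)).indicator 1 (x + c) else 0) := by
      intro K _
      simp only [hq']
      split_ifs with h
      · subst h; push_cast; ring
      · ring
    rw [Finset.sum_congr rfl this, Finset.sum_add_distrib, Finset.sum_ite_eq' _ (0 : ℕ),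
      if_pos h0mem]
    ring
  -- the integral of `s` is `T · v`
  have hint_s : ∫ x, s x = T * v := by
    simp only [hsdef]
    rw [integral_finsetSum _ fun K _ => integrable_const_mul_indicator_hoCube j _ _ c]
    simp_rw [integral_const_mul_indicator_hoCube]
    rw [← Finset.sum_mul, hT]
    push_cast
    rfl
  have hTv : |(T : ℝ)| * v ≤ ε / 2 := by
    have h1 : |∫ x, s x| = |∫ x, (s x - g x)| := by
      rw [integral_sub hsi hg, hg0, sub_zero]
    have h2 : |∫ x, (s x - g x)| ≤ ∫ x, |s x - g x| := abs_integral_le_integral_abs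
    have h3 : ∫ x, |s x - g x| = ∫ x, |g x - s x| := by
      congr 1
      funext x
      exact abs_sub_comm _ _
    calc |(T : ℝ)| * v = |(T : ℝ) * v| := by rw [abs_mul, abs_of_pos hv0]
      _ = |∫ x, s x| := by rw [hint_s]
      _ ≤ ε / 2 := by rw [h1]; exact h2.trans (h3 ▸ hs)
  have hdi : Integrable d := integrable_const_mul_indicator_hoCube j _ _ c
  have hs'i : Integrable s' := by
    have : s' = fun x => s x - d x := funext hss'
    rw [this]
    exact hsi.sub hdi
  have hd_int : ∫ x, |d x| = |(T : ℝ)| * v := by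
    have : ∀ x, |d x| = |(T : ℝ)| * (hoCube j (digits n L 0)).indicator 1 (x + c) := fun x => by
      simp only [hd]
      rw [abs_mul]
      congr 1
      exact abs_of_nonneg (indicator_nonneg (fun _ _ => zero_le_one) _)
    simp_rw [this]
    exact integral_const_mul_indicator_hoCube j _ _ c
  refine ⟨j, L, R, q', hL0, hLR, hsum', hs'i, ?_⟩
  show ∫ x, |g x - s' x| ≤ ε
  have hs1 : ∫ x, |g x - s x| ≤ ε / 2 := hs
  have i1 : Integrable (fun x => |g x - s x|) := (hg.sub hsi).abs
  have i2 : Integrable (fun x => |d x|) := hdi.abs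
  have i3 : Integrable (fun x => |g x - s' x|) := (hg.sub hs'i).abs
  have h4 : ∫ x, |g x - s' x| ≤ (∫ x, |g x - s x|) + ∫ x, |d x| := by
    rw [← integral_add i1 i2]
    refine integral_mono i3 (i1.add i2) fun x => ?_
    show |g x - s' x| ≤ |g x - s x| + |d x|
    rw [hss']
    calc |g x - (s x - d x)| = |(g x - s x) + d x| := by ring_nf
      _ ≤ |g x - s x| + |d x| := abs_add_le _ _
  have h5 : ∫ x, |d x| ≤ ε / 2 := hd_int ▸ hTv
  calc ∫ x, |g x - s' x| ≤ ε / 2 + ε / 2 := h4.trans (add_le_add hs1 h5)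
    _ = ε := add_halves ε

/-- **Registered sub-goal `ratStep_dense` (line `registered`, stmt-KontsevichZagierPeriods-3155):**
zero-sum rational step functions on translated dyadic grids are `L¹`-dense in the zero-integral
integrable functions on `ℝⁿ` (closed form of `exists_step_integral_abs_sub_le_of_integral_eq_zero`).
[cite: Yoshinaga2008, §3.4] -/
theorem ratStep_dense : ∀ {n : ℕ} (g : (Fin n → ℝ) → ℝ), Integrable g → ∫ x, g x = 0 →
    ∀ {ε : ℝ}, 0 < ε → ∃ (j L R : ℕ) (q : ℕ → ℚ), 0 < L ∧ (L : ℝ) / 2 ^ j = 2 * R ∧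
      ∑ K ∈ Finset.range (L ^ n), q K = 0 ∧
      Integrable (fun x => ∑ K ∈ Finset.range (L ^ n),
        (q K : ℝ) * (hoCube j (digits n L K)).indicator 1 (x + fun _ : Fin n => (R : ℝ))) ∧
      ∫ x, |g x - ∑ K ∈ Finset.range (L ^ n),
        (q K : ℝ) * (hoCube j (digits n L K)).indicator 1 (x + fun _ : Fin n => (R : ℝ))| ≤ ε :=
  fun g hg hg0 _ hε => exists_step_integral_abs_sub_le_of_integral_eq_zero g hg hg0 hε

end Summit.KontsevichZagierPeriods.StandardParts
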